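import Mathlib
import Summits.Ventures.PercRepro2.TypedStarGenK5
import Summits.Ventures.PercRepro2.TypedStarPieces
import Summits.Ventures.PercRepro2.K5TypedK3Marks

/-!
# THE MULTIGRAPH PIECES ARE THEOREMS, I: `N(H)`, `N(H + e(1))`, `N(H + e(2))`
(blind cell PercRepro2, p2 g2, 2026-08-25; sub-claim S1 (C) — the certificate list of
TypedStarPieces.lean shrinks to `pT1`, `pT2`, the three `pM` and one `pB + pM S*`)

`K₅` with extra edges PARALLEL to its pairs (`endsPar par`: the edge `inr i` is a copy of the pair
`par i`) is an all-marked loop-free multigraph, so its typed `K₃` base is nonnegative by typer-1's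
`typedCount_K3_nonneg_multi` (K5TypedK3Marks.lean).  Splitting the extra edges off
(`typedCount_split_list`) and reading a copy in which some extras are open as the `K₅` pattern with the
corresponding pairs forced open (`conn_iff_par`, `K3_par`) writes that typed base as a placement sum of
masked `K₅` counts (`typedCount_K3_par`): with one extra edge of type `1` / `2` this is `pE` / `pE2`,
with two extra edges of type `1` on two different pairs of a triangle it is `pC S S' + pT1` (a copy
with both open sees the path, which connects exactly what the triangle does: `mcount_path_eq_tri`).

* **`pN_nonneg`**, **`pE_nonneg`**, **`pE2_nonneg`**, **`pC_pT1_nonneg`** — the four multigraph pieces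
  are `≥ 0` for every typed set of mark pairs and every type map, at the three markings;
* **`StarPieces` from the five certified pieces**: `starPieces_of_certs`.

Own code; standard axioms.
-/

namespace Summit.Ventures.PercRepro2

open Hub

namespace K5

/-! ## `K₅` with parallel extra edges -/

section Par

variable {k : ℕ}

/-- The ends of `K₅` with `k` extra edges, the extra edge `i` parallel to the pair `par i`. -/
def endsPar (par : Fin k → Fin 10) : Fin 10 ⊕ Fin k → Sym2 (Fin 5) :=
  Sum.elim ends5 fun i => ends5 (par i)

/-- The `K₅` part of a configuration of the multigraph. -/
def projK5 (x : Config (Fin 10 ⊕ Fin k)) : Config (Fin 10) := fun j => x (Sum.inl j)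

/-- The pairs carried by the open extra edges. -/
def extMask (par : Fin k → Fin 10) (x : Config (Fin 10 ⊕ Fin k)) : Fin 10 → Bool :=
  fun j => decide (∃ i, par i = j ∧ x (Sum.inr i) = true)

/-- Open adjacency in the multigraph is open adjacency of `K₅` at the masked projection. -/
lemma openAdj_par_iff (par : Fin k → Fin 10) (x : Config (Fin 10 ⊕ Fin k)) (u v : Fin 5) :
    OpenAdj (endsPar par) x u v ↔ OpenAdj ends5 (orOn (extMask par x) (projK5 x)) u v := by
  constructor
  · rintro ⟨e, he, hends⟩
    cases e with
    | inl j =>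
      refine ⟨j, ?_, hends⟩
      simp [orOn, projK5, he]
    | inr i =>
      refine ⟨par i, ?_, hends⟩
      have : extMask par x (par i) = true := by
        unfold extMask; rw [decide_eq_true_iff]; exact ⟨i, rfl, he⟩
      simp [orOn, this]
  · rintro ⟨j, hj, hends⟩
    unfold orOn at hj
    rw [Bool.or_eq_true] at hj
    rcases hj with hj | hj
    · exact ⟨Sum.inl j, hj, hends⟩
    · unfold extMask at hj
      rw [decide_eq_true_iff] at hj
      obtain ⟨i, hi, hx⟩ := hj
      refine ⟨Sum.inr i, hx, ?_⟩
      simp [endsPar, hi, hends]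

/-- The open graphs coincide. -/
lemma openGraph_par (par : Fin k → Fin 10) (x : Config (Fin 10 ⊕ Fin k)) :
    openGraph (endsPar par) x = openGraph ends5 (orOn (extMask par x) (projK5 x)) := by
  ext u v
  rw [openGraph_adj, openGraph_adj, openAdj_par_iff]

/-- **Connections in the multigraph are connections of `K₅` at the masked projection.** -/
theorem conn_iff_par (par : Fin k → Fin 10) (x : Config (Fin 10 ⊕ Fin k)) (u v : Fin 5) :
    Conn (endsPar par) x u v ↔ Conn ends5 (orOn (extMask par x) (projK5 x)) u v := by
  unfold Conn
  rw [openGraph_par]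

variable {R : Type*} [Field R]

/-- The indicator of a connection event of the parallel-extended graph at `x` equals the
indicator of the `K₅` connection event at the projected configuration with the extra mask. -/
lemma indicator_connEvent_par (par : Fin k → Fin 10) (x : Config (Fin 10 ⊕ Fin k)) (u v : Fin 5) :
    (connEvent (endsPar par) u v).indicator (1 : Config (Fin 10 ⊕ Fin k) → R) x =
      (connEvent ends5 u v).indicator (1 : Config (Fin 10) → R) (orOn (extMask par x) (projK5 x)) := by
  refine indicator_eq_of_iff ?_
  rw [mem_connEvent, mem_connEvent, conn_iff_par]

/-- The indicator of the avoidance event `a₂ ↮ a₁` transfers to `K₅` under the projection. -/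
lemma indicator_avoidAll_par (par : Fin k → Fin 10) (x : Config (Fin 10 ⊕ Fin k)) (a₁ a₂ : Fin 5) :
    (avoidAll (endsPar par) a₂ {a₁}).indicator (1 : Config (Fin 10 ⊕ Fin k) → R) x =
      (avoidAll ends5 a₂ {a₁}).indicator (1 : Config (Fin 10) → R) (orOn (extMask par x) (projK5 x)) := by
  refine indicator_eq_of_iff ?_
  simp only [mem_avoidAll, Finset.mem_singleton, forall_eq]
  rw [conn_iff_par]

/-- The indicator of the `PD` event transfers to `K₅` under the projection with the extra mask. -/
lemma indicator_PDEvent_par (par : Fin k → Fin 10) (x : Config (Fin 10 ⊕ Fin k)) (a₁ a₂ a₃ : Fin 5) :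
    (PDEvent (endsPar par) a₁ a₂ a₃).indicator (1 : Config (Fin 10 ⊕ Fin k) → R) x =
      (PDEvent ends5 a₁ a₂ a₃).indicator (1 : Config (Fin 10) → R) (orOn (extMask par x) (projK5 x)) := by
  refine indicator_eq_of_iff ?_
  simp only [PDEvent, Dtilde, UnionCluster.inU, Set.mem_inter_iff, Set.mem_compl_iff, Set.mem_union,
    mem_connEvent]
  rw [conn_iff_par, conn_iff_par, conn_iff_par]

/-- **The kernel `K₃` of the multigraph is the kernel of `K₅` at the masked projections.** -/
theorem K3_par (par : Fin k → Fin 10) (o a₁ a₂ a₃ b : Fin 5) (x y w : Config (Fin 10 ⊕ Fin k)) :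
    CovForm.K3 (R := R) (endsPar par) o a₁ a₂ a₃ b x y w =
      CovForm.K3 (R := R) ends5 o a₁ a₂ a₃ b (orOn (extMask par x) (projK5 x))
        (orOn (extMask par y) (projK5 y)) (orOn (extMask par w) (projK5 w)) := by
  unfold CovForm.K3 CovForm.sepKernel CovForm.f3 CovForm.f4 CovForm.f5 CovForm.f6 CovForm.f7 CovForm.f10
    CovForm.f11 CovForm.f12 CovForm.sigma CovForm.inU CovForm.iQ CovForm.iPD CovForm.iL CovForm.iH
  simp only [Fin.sum_univ_succ, Fin.sum_univ_zero, Matrix.cons_val_zero, Matrix.cons_val_succ, add_zero,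
    indicator_connEvent_par, indicator_avoidAll_par, indicator_PDEvent_par]

end Par

/-! ## The typed count of the multigraph as a placement sum -/

section Count

variable {R : Type*} [Field R]

/-- The type map of the multigraph: `τ` on `K₅`, `t` on the extra edges. -/
def parτ {k : ℕ} (τ : Fin 10 → ℕ) (t : Fin k → ℕ) : Fin 10 ⊕ Fin k → ℕ := Sum.elim τ t

/-- The `K₅` part of a typed set, as a typed set of the multigraph. -/
def inlF (k : ℕ) (F : Finset (Fin 10)) : Finset (Fin 10 ⊕ Fin k) :=
  F.map ⟨Sum.inl, Sum.inl_injective⟩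

/-- Membership of a left-injected edge in `inlF k F`. -/
lemma mem_inlF_inl {k : ℕ} (F : Finset (Fin 10)) (j : Fin 10) :
    (Sum.inl j : Fin 10 ⊕ Fin k) ∈ inlF k F ↔ j ∈ F := by
  simp [inlF]

/-- An extra (right-injected) edge never lies in `inlF k F`. -/
lemma not_mem_inlF_inr {k : ℕ} (F : Finset (Fin 10)) (i : Fin k) :
    (Sum.inr i : Fin 10 ⊕ Fin k) ∉ inlF k F := by
  simp [inlF]

/-- The typed triples of the `K₅` part of the multigraph are the typed triples of `K₅`: the count of a
kernel that reads only the projections. -/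
lemma typedCount_inlF_proj {k : ℕ} (F : Finset (Fin 10)) (τ : Fin 10 → ℕ) (t : Fin k → ℕ)
    (K : Config (Fin 10) → Config (Fin 10) → Config (Fin 10) → R) :
    typedCount (inlF k F) (fun _ => false) (parτ τ t)
        (fun x y w => K (projK5 x) (projK5 y) (projK5 w)) =
      typedCount F (fun _ => false) τ K := by
  rw [typedCount_eq_sum_triples, typedCount_eq_sum_triples]
  refine sum_ite_nbij _ _ _ _ (fun s => (projK5 s.1, projK5 s.2.1, projK5 s.2.2)) _ _ ?_ ?_ ?_ ?_
  · rintro ⟨x, y, w⟩ ⟨hoff, hon⟩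
    refine ⟨fun j hj => ?_, fun j hj => ?_⟩
    · exact hoff (Sum.inl j) (fun h => hj ((mem_inlF_inl F j).1 h))
    · exact hon (Sum.inl j) ((mem_inlF_inl F j).2 hj)
  · rintro ⟨x, y, w⟩ ⟨x', y', w'⟩ ⟨hoff, -⟩ ⟨hoff', -⟩ h
    simp only [Prod.mk.injEq] at h
    obtain ⟨h1, h2, h3⟩ := h
    refine Prod.ext ?_ (Prod.ext ?_ ?_)
    · funext e
      cases e with
      | inl j => exact congrFun h1 j
      | inr i => rw [(hoff _ (not_mem_inlF_inr F i)).1, (hoff' _ (not_mem_inlF_inr F i)).1]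
    · funext e
      cases e with
      | inl j => exact congrFun h2 j
      | inr i => rw [(hoff _ (not_mem_inlF_inr F i)).2.1, (hoff' _ (not_mem_inlF_inr F i)).2.1]
    · funext e
      cases e with
      | inl j => exact congrFun h3 j
      | inr i => rw [(hoff _ (not_mem_inlF_inr F i)).2.2, (hoff' _ (not_mem_inlF_inr F i)).2.2]
  · rintro ⟨x, y, w⟩ ⟨hoff, hon⟩
    refine ⟨(Sum.elim x fun _ => false, Sum.elim y fun _ => false, Sum.elim w fun _ => false),
      ⟨fun e he => ?_, fun e he => ?_⟩, rfl⟩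
    · cases e with
      | inl j => exact hoff j (fun h => he ((mem_inlF_inl F j).2 h))
      | inr i => exact ⟨rfl, rfl, rfl⟩
    · cases e with
      | inl j => exact hon j ((mem_inlF_inl F j).1 he)
      | inr i => exact absurd he (not_mem_inlF_inr F i)
  · rintro ⟨x, y, w⟩ -
    rfl


end Count

/-! ## One extra edge: `pE` and `pE2` -/

section One

variable {R : Type*} [Field R]

/-- The mask of one pair index. -/
def edgeMask (j₀ : Fin 10) : Fin 10 → Bool := fun j => decide (j₀ = j)

/-- The edge mask of the pair `{p, q}` is `pairMask p q`. -/
lemma edgeMask_eq_pairMask {j₀ : Fin 10} {p q : Fin 5} (h : ends5 j₀ = s(p, q)) :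
    edgeMask j₀ = pairMask p q := by
  funext j
  rw [Bool.eq_iff_iff, edgeMask, decide_eq_true_iff, pairMask_eq_true_iff]
  constructor
  · rintro rfl; exact h
  · intro hj; exact ends5_injective (h.trans hj.symm)

/-- The extra mask of a star state on one extra edge. -/
lemma extMask_one (j₀ : Fin 10) (a : Bool) (x : Config (Fin 10 ⊕ Fin 1)) :
    extMask (fun _ : Fin 1 => j₀) (Function.update x (Sum.inr 0) a) = if a then edgeMask j₀ else mNone := by
  funext j
  unfold extMask edgeMask mNone
  cases a <;> simp [Fin.exists_fin_one]

/-- Updating an extra edge does not change the projection to `K₅`. -/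
lemma projK5_update_inr {k : ℕ} (x : Config (Fin 10 ⊕ Fin k)) (i : Fin k) (a : Bool) :
    projK5 (Function.update x (Sum.inr i) a) = projK5 x := by
  funext j
  simp [projK5, Function.update_of_ne]

/-- **`K₅` plus one extra edge parallel to the pair `j₀`, typed `t`**: the typed count of the multigraph
is the placement sum of the masked `K₅` counts. -/
theorem typedCount_par1 (F : Finset (Fin 10)) (τ : Fin 10 → ℕ) (j₀ : Fin 10) (t : ℕ)
    (o a₁ a₂ a₃ b : Fin 5) :
    typedCount (insert (Sum.inr 0) (inlF 1 F)) (fun _ => false) (parτ τ fun _ => t)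
        (CovForm.K3 (R := R) (endsPar fun _ : Fin 1 => j₀) o a₁ a₂ a₃ b) =
      ∑ a : Bool, ∑ b' : Bool, ∑ c : Bool, if a.toNat + b'.toNat + c.toNat = t then
        mcount F (fun _ => false) τ (if a then edgeMask j₀ else mNone) (if b' then edgeMask j₀ else mNone)
          (if c then edgeMask j₀ else mNone) (CovForm.K3 (R := R) ends5 o a₁ a₂ a₃ b) else 0 := by
  rw [CovForm.TypedRed.typedCount_split _ (Sum.inr 0) (Finset.mem_insert_self _ _),
    Finset.erase_insert (not_mem_inlF_inr F 0), Function.update_eq_self]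
  refine Finset.sum_congr rfl fun a _ => Finset.sum_congr rfl fun b' _ =>
    Finset.sum_congr rfl fun c _ => ?_
  have ht : parτ τ (fun _ : Fin 1 => t) (Sum.inr 0) = t := rfl
  rw [ht]
  by_cases hA : a.toNat + b'.toNat + c.toNat = t
  · rw [if_pos hA, if_pos hA]
    unfold mcount
    rw [← typedCount_inlF_proj F τ (fun _ => t)]
    refine typedCount_congr_closedOff _ _ _ _ fun x y w _ _ _ => ?_
    rw [K3_par]
    simp only [extMask_one, projK5_update_inr]
  · rw [if_neg hA, if_neg hA]

/-- `pE` is the typed count of `K₅` plus one parallel edge of type `1`. -/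
lemma pE_eq_par1 (F : Finset (Fin 10)) (τ : Fin 10 → ℕ) (j₀ : Fin 10) (o a₁ a₂ a₃ b : Fin 5) :
    pE F (fun _ => false) τ (CovForm.K3 (R := R) ends5 o a₁ a₂ a₃ b) (edgeMask j₀) =
      typedCount (insert (Sum.inr 0) (inlF 1 F)) (fun _ => false) (parτ τ fun _ => 1)
        (CovForm.K3 (R := R) (endsPar fun _ : Fin 1 => j₀) o a₁ a₂ a₃ b) := by
  rw [typedCount_par1]
  simp only [Fintype.sum_bool, Bool.toNat_true, Bool.toNat_false, Nat.reduceEqDiff, if_true, if_false,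
    add_zero, zero_add, Bool.false_eq_true]
  unfold pE
  ring

/-- `pE2` is the typed count of `K₅` plus one parallel edge of type `2`. -/
lemma pE2_eq_par1 (F : Finset (Fin 10)) (τ : Fin 10 → ℕ) (j₀ : Fin 10) (o a₁ a₂ a₃ b : Fin 5) :
    pE2 F (fun _ => false) τ (CovForm.K3 (R := R) ends5 o a₁ a₂ a₃ b) (edgeMask j₀) =
      typedCount (insert (Sum.inr 0) (inlF 1 F)) (fun _ => false) (parτ τ fun _ => 2)
        (CovForm.K3 (R := R) (endsPar fun _ : Fin 1 => j₀) o a₁ a₂ a₃ b) := by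
  rw [typedCount_par1]
  simp only [Fintype.sum_bool, Bool.toNat_true, Bool.toNat_false, Nat.reduceEqDiff, if_true, if_false,
    add_zero, zero_add, Bool.false_eq_true]
  unfold pE2
  ring


end One

section Nonneg

variable {R : Type*} [Field R] [LinearOrder R] [IsStrictOrderedRing R]

/-- The marks `(0, 1, 2, 3, b)`, `b ∈ {4, 3, 0}`, satisfy the distinctness hypotheses of typer-1's
multigraph theorem. -/
lemma marks_distinct_of (b : Fin 5) (hb : b = 4 ∨ b = 3 ∨ b = 0) :
    (1 : Fin 5) ≠ 2 ∧ (3 : Fin 5) ≠ 1 ∧ (3 : Fin 5) ≠ 2 ∧ (0 : Fin 5) ≠ 1 ∧ (0 : Fin 5) ≠ 2 ∧ b ≠ 1 ∧ b ≠ 2 ∧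
      (0 : Fin 5) ≠ 3 := by
  rcases hb with rfl | rfl | rfl <;> decide

/-- A pair of marks (`ends5 j₀` inside the marks). -/
def MarkEdge (b : Fin 5) (j₀ : Fin 10) : Prop := ∀ v ∈ ends5 j₀, v = 0 ∨ v = 1 ∨ v = 2 ∨ v = 3 ∨ v = b

/-- **The typed count of `K₅` plus one parallel mark edge is nonnegative** (typer-1's multigraph
theorem). -/
lemma par1_nonneg (b : Fin 5) (hb : b = 4 ∨ b = 3 ∨ b = 0) (F : Finset (Fin 10))
    (hF : MarkPairs 0 1 2 3 b F) (τ : Fin 10 → ℕ) (j₀ : Fin 10) (hj : MarkEdge b j₀) (t : ℕ) :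
    0 ≤ typedCount (insert (Sum.inr 0) (inlF 1 F)) (fun _ => false) (parτ τ fun _ => t)
        (CovForm.K3 (R := R) (endsPar fun _ : Fin 1 => j₀) 0 1 2 3 b) := by
  obtain ⟨h12, h31, h32, h01, h02, hb1, hb2, h03⟩ := marks_distinct_of b hb
  refine typedCount_K3_nonneg_multi_loops _ h12 h31 h32 h01 h02 hb1 hb2 h03 _ _ fun e he v hv => ?_
  rcases Finset.mem_insert.1 he with rfl | he
  · exact hj v hv
  · obtain ⟨j, hjF, rfl⟩ := Finset.mem_map.1 he
    exact hF j hjF v hv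

/-- **`pE` at a mark pair is nonnegative.** -/
theorem pE_nonneg (b : Fin 5) (hb : b = 4 ∨ b = 3 ∨ b = 0) (F : Finset (Fin 10))
    (hF : MarkPairs 0 1 2 3 b F) (τ : Fin 10 → ℕ) {p q : Fin 5} (hpq : p ≠ q)
    (hp : p = 0 ∨ p = 1 ∨ p = 2 ∨ p = 3 ∨ p = b) (hq : q = 0 ∨ q = 1 ∨ q = 2 ∨ q = 3 ∨ q = b) :
    0 ≤ pE F (fun _ => false) τ (CovForm.K3 (R := R) ends5 0 1 2 3 b) (pairMask p q) := by
  obtain ⟨j₀, hj₀⟩ := exists_edge5 p q hpq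
  rw [← edgeMask_eq_pairMask hj₀, pE_eq_par1]
  refine par1_nonneg b hb F hF τ j₀ (fun v hv => ?_) 1
  rw [hj₀] at hv
  rcases Sym2.mem_iff.1 hv with rfl | rfl
  · exact hp
  · exact hq

/-- **`pE2` at a mark pair is nonnegative.** -/
theorem pE2_nonneg (b : Fin 5) (hb : b = 4 ∨ b = 3 ∨ b = 0) (F : Finset (Fin 10))
    (hF : MarkPairs 0 1 2 3 b F) (τ : Fin 10 → ℕ) {p q : Fin 5} (hpq : p ≠ q)
    (hp : p = 0 ∨ p = 1 ∨ p = 2 ∨ p = 3 ∨ p = b) (hq : q = 0 ∨ q = 1 ∨ q = 2 ∨ q = 3 ∨ q = b) :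
    0 ≤ pE2 F (fun _ => false) τ (CovForm.K3 (R := R) ends5 0 1 2 3 b) (pairMask p q) := by
  obtain ⟨j₀, hj₀⟩ := exists_edge5 p q hpq
  rw [← edgeMask_eq_pairMask hj₀, pE2_eq_par1]
  refine par1_nonneg b hb F hF τ j₀ (fun v hv => ?_) 2
  rw [hj₀] at hv
  rcases Sym2.mem_iff.1 hv with rfl | rfl
  · exact hp
  · exact hq

/-- **`pN` is nonnegative** (the `K₅` base: typer-1's certificate). -/
theorem pN_nonneg (b : Fin 5) (hb : b = 4 ∨ b = 3 ∨ b = 0) (F : Finset (Fin 10))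
    (hF : MarkPairs 0 1 2 3 b F) (τ : Fin 10 → ℕ) :
    0 ≤ pN F (fun _ => false) τ (CovForm.K3 (R := R) ends5 0 1 2 3 b) := by
  obtain ⟨h12, h31, h32, h01, h02, hb1, hb2, h03⟩ := marks_distinct_of b hb
  have horOn : ∀ x : Config (Fin 10), orOn mNone x = x := by
    intro x; funext j; simp [orOn, mNone]
  unfold pN mcount
  simp only [horOn]
  exact typedCount_K3_nonneg_multi_loops ends5 h12 h31 h32 h01 h02 hb1 hb2 h03 F τ fun j hj v hv =>
    hF j hj v hv


end Nonneg

end K5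

end Summit.Ventures.PercRepro2
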